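import Literature.NumberTheory.LFunctions.LargeValuesTraceExpansion
import Mathlib.Analysis.Calculus.BumpFunction.Basic
import Mathlib.Analysis.MeanInequalitiesPow
import HarnessLib

/-!
# The assembly of Guth–Maynard's Proposition 3.1 (§12) and the reduction of `zeroDensity_guth_maynard` to the bounds for `S₂`, `S₃` and the energy

Topic `NumberTheory/LFunctions`, family RH. With `ZeroDensityGuthMaynardWindow.lean` (§13),
`LargeValuesGuthMaynardReduction.lean` (§3), `LargeValuesTraceMethod.lean` (Lemmas 4.1–4.2),
`LargeValuesFourierDecay.lean` (Lemma 4.3, Poisson summation) and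
`LargeValuesTraceExpansion.lean` (Lemmas 4.4–4.5, Propositions 4.6 and 5.1), this file closes the
"book-keeping" layer of L. Guth, J. Maynard, *New large value estimates for Dirichlet polynomials*,
Ann. of Math. 203 (2026), around the tree's named fact
`Literature.NumberTheory.LFunctions.zeroDensity_guth_maynard` (Theorem 1.2 of the paper). It PROVES:

* `GuthMaynardAssembly.keyProp_optimisation` — the optimisation in the proof of Proposition 3.1
  (§12): from `|W| ≪ N^{2−2σ} + N^{1−2σ}(S₂ + S₃)^{1/3}` and the bounds of Propositions 6.1 (`k = 4`)
  and 11.2 one gets `|W|³N^{6σ−3} ⪅ N³ + (eight terms)`, whence (12.1) and, for `T = N^{6/5}` and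
  `σ ∈ [7/10, 8/10]`, `|W| ⪅ T N^{(12−20σ)/5}` (all eight exponent comparisons are checked);
* `GuthMaynardAssembly.S2_add_S3_numeric` — Proposition 11.2 (substituting the energy bound of
  Proposition 11.1 into Proposition 10.1), added to the `S₂` bound;
* `GuthMaynardAssembly.keyProp_of_bounds` — **Proposition 3.1 for a weight `w`** from three
  hypotheses on the objects `S2 w N W`, `S3 w N W` (`LargeValuesTraceExpansion.lean`) and the
  additive energy `addEnergy W = #{(t₁,t₂,t₃,t₄) ∈ W⁴ : |t₁+t₂−t₃−t₄| ≤ 1}`: Proposition 6.1 with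
  `k = 4` (`S₂ ⪅ N²|W|² + TN|W|^{7/4} + N²T^{1/8}|W|^{29/16}`), Proposition 10.1
  (`S₃ ⪅ T²|W|^{3/2} + TN|W|^{1/2}E(W)^{1/2}`) and Proposition 11.1 for `T = N^{6/5}`
  (`E(W) ⪅ |W|N^{4−4σ} + |W|^{21/8}T^{1/4}N^{1−2σ} + |W|³N^{1−2σ}`), each in the form
  "for every `δ > 0`, all `N ≥ N₀`, with a factor `C N^δ`";
* `GuthMaynardAssembly.exists_weight` — a smooth `w : ℝ → [0,1]` supported in `[1,2]`, equal to `1`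
  on `[6/5, 9/5]` (the weight fixed in §3 of the paper), from Mathlib's `ContDiffBump`;
* `GuthMaynardAssembly.zeroDensity_guth_maynard_of_bounds` — **the named fact
  `zeroDensity_guth_maynard` from the three analytic cores** (Propositions 6.1, 10.1, 11.1, stated for
  all admissible weights), via `zeroDensity_guth_maynard_of_keyProp`.

What remains for an unconditional discharge of `zeroDensity_guth_maynard` is therefore exactly:
Proposition 6.1 (§6: the approximate functional equation, Lemma 6.2, and Heath-Brown's theorem
[Heath-Brown 1979]), Proposition 10.1 (§§7–10: the `R`-function, the affine-transformation sums of
§9) and Proposition 11.1 (§11, again via Heath-Brown's theorem). No named fact is introduced here;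
everything in this file is proved.

## References

* L. Guth, J. Maynard, *New large value estimates for Dirichlet polynomials*, Ann. of Math. (2)
  203 (2026), no. 2; arXiv:2405.20552 (2024): Propositions 3.1, 6.1, 10.1, 11.1, 11.2, §12
  (proof of Proposition 3.1, eq. (12.1)), §3 (the weight `w`).
* D. R. Heath-Brown, *A large values estimate for Dirichlet polynomials*, J. London Math. Soc. (2)
  20 (1979), 8–18 (the cite `[HB]` of the paper; Theorem 1.6 there).
-/

noncomputable section

open Real Finset
open scoped ContDiff

namespace Literature.NumberTheory.LFunctions

namespace GuthMaynardAssembly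

/-- **Solving `X³ ≤ ∑ A_i X^{a_i}` for `X`**: if `a_i < 3` and `A_i ≥ 0` then
`X ≤ ∑_i (|s| A_i)^{1/(3−a_i)}`. [folklore] -/
theorem le_sum_rpow_of_cube_le {ι : Type*} (s : Finset ι) {X : ℝ} (A a : ι → ℝ)
    (hA : ∀ i ∈ s, 0 ≤ A i) (ha : ∀ i ∈ s, a i < 3)
    (h : X ^ 3 ≤ ∑ i ∈ s, A i * X ^ (a i)) :
    X ≤ ∑ i ∈ s, ((s.card : ℝ) * A i) ^ (1 / (3 - a i)) := by
  by_contra hlt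
  push Not at hlt
  have hRHS0 : 0 ≤ ∑ i ∈ s, ((s.card : ℝ) * A i) ^ (1 / (3 - a i)) :=
    Finset.sum_nonneg fun i hi ↦ Real.rpow_nonneg (by have := hA i hi; positivity) _
  have hX0 : 0 < X := lt_of_le_of_lt hRHS0 hlt
  rcases s.eq_empty_or_nonempty with hs | hs
  · subst hs
    simp only [Finset.sum_empty] at h hlt
    nlinarith [pow_pos hX0 3]
  have hcard : (0 : ℝ) < s.card := by exact_mod_cast hs.card_pos
  -- each term is `< X³ / |s|`
  have hterm : ∀ i ∈ s, A i * X ^ (a i) < X ^ 3 / s.card := by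
    intro i hi
    have hai : 0 < 3 - a i := by linarith [ha i hi]
    have h1 : ((s.card : ℝ) * A i) ^ (1 / (3 - a i)) < X :=
      lt_of_le_of_lt (Finset.single_le_sum (f := fun i ↦ ((s.card : ℝ) * A i) ^ (1 / (3 - a i)))
        (fun j hj ↦ Real.rpow_nonneg (by have := hA j hj; positivity) _) hi) hlt
    have h2 : (s.card : ℝ) * A i < X ^ (3 - a i) := by
      have h0 : 0 ≤ (s.card : ℝ) * A i := by have := hA i hi; positivity
      have := Real.rpow_lt_rpow (Real.rpow_nonneg h0 _) h1 hai
      rwa [one_div, Real.rpow_inv_rpow h0 hai.ne'] at this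
    have h3 : X ^ (3 - a i) * X ^ (a i) = X ^ 3 := by
      rw [← Real.rpow_add hX0, sub_add_cancel, show (3 : ℝ) = (3 : ℕ) by norm_num,
        Real.rpow_natCast]
    rw [lt_div_iff₀ hcard, ← h3]
    have hXa : 0 < X ^ (a i) := Real.rpow_pos_of_pos hX0 _
    nlinarith
  have hsum : ∑ i ∈ s, A i * X ^ (a i) < ∑ i ∈ s, X ^ 3 / s.card :=
    Finset.sum_lt_sum_of_nonempty hs hterm
  rw [Finset.sum_const, nsmul_eq_mul, mul_div_cancel₀ _ hcard.ne'] at hsum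
  linarith

/-- `(K A)^{1/p} n^{(e+δ)/p} ≤ max(1, K A) · n^{E + δ}` when `1 ≤ p`, `e/p ≤ E`, `n ≥ 1`, `δ ≥ 0`.
[folklore] -/
theorem rpow_term_le {K e p E δ n : ℝ} (hK : 0 ≤ K) (hp : 1 ≤ p) (heE : e / p ≤ E) (hn : 1 ≤ n)
    (hδ : 0 ≤ δ) : (K * n ^ (e + δ)) ^ (1 / p) ≤ max 1 K * n ^ (E + δ) := by
  have hp0 : 0 < p := by linarith
  have hn0 : 0 < n := by linarith
  rw [Real.mul_rpow hK (Real.rpow_nonneg hn0.le _), ← Real.rpow_mul hn0.le]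
  have h1 : K ^ (1 / p) ≤ max 1 K := by
    rcases le_or_gt K 1 with hK1 | hK1
    · exact (Real.rpow_le_one hK hK1 (by positivity)).trans (le_max_left _ _)
    · calc K ^ (1 / p) ≤ K ^ (1 : ℝ) :=
            Real.rpow_le_rpow_of_exponent_le hK1.le (by rw [div_le_one hp0]; exact hp)
        _ = K := Real.rpow_one K
        _ ≤ max 1 K := le_max_right _ _
  have h2 : n ^ ((e + δ) * (1 / p)) ≤ n ^ (E + δ) := by
    apply Real.rpow_le_rpow_of_exponent_le hn
    rw [add_mul, mul_one_div, mul_one_div]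
    have : δ / p ≤ δ := div_le_self hδ hp
    linarith
  exact mul_le_mul h1 h2 (Real.rpow_nonneg hn0.le _) (le_trans zero_le_one (le_max_left _ _))

set_option maxHeartbeats 1000000 in
/-- **The optimisation of §12 (proof of Proposition 3.1), abstract form.** Let `7/10 ≤ σ ≤ 4/5`,
`n ≥ 1`, `T = n^{6/5}`, `δ ≥ 0`, `X, S ≥ 0` with
`X ≤ C₀ (n^{2−2σ} + n^{1−2σ} S^{1/3})` (Proposition 4.6 with `S = |S₂ + S₃|`, `S₁` negligible) and
`S ≤ C₁ n^δ (n²X² + TnX^{7/4} + n²T^{1/8}X^{29/16} + T²X^{3/2} + TXn^{3−2σ} + TX²n^{3/2−σ} + T^{9/8}X^{29/16}n^{3/2−σ})`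
(Proposition 6.1 with `k = 4` and Proposition 11.2). Then `X ≤ C n^δ · T n^{(12−20σ)/5}` with `C`
depending only on `C₀, C₁`: "`|W|³N^{6σ−3} ⪅ N³ + S₂ + S₃ ⪅ …`, which rearranges to (12.1); we
choose `k = 4` … if `σ ∈ [7/10, 8/10]` the first and third terms can be dropped and we get
`|W| ⪅ T N^{(12−20σ)/5}`." [cite: GuthMaynard2026, Section 12, proof of Proposition 3.1] -/
theorem keyProp_optimisation (C₀ C₁ : ℝ) (hC₀ : 0 ≤ C₀) (hC₁ : 0 ≤ C₁) :
    ∃ C, 0 ≤ C ∧ ∀ (σ n δ X S : ℝ), 7 / 10 ≤ σ → σ ≤ 4 / 5 → 1 ≤ n → 0 ≤ δ → 0 ≤ X → 0 ≤ S →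
      X ≤ C₀ * (n ^ (2 - 2 * σ) + n ^ (1 - 2 * σ) * S ^ (1 / 3 : ℝ)) →
      S ≤ C₁ * n ^ δ * (n ^ 2 * X ^ 2 + n ^ (6 / 5 : ℝ) * n * X ^ (7 / 4 : ℝ) +
        n ^ 2 * (n ^ (6 / 5 : ℝ)) ^ (1 / 8 : ℝ) * X ^ (29 / 16 : ℝ) +
        (n ^ (6 / 5 : ℝ)) ^ 2 * X ^ (3 / 2 : ℝ) + n ^ (6 / 5 : ℝ) * X * n ^ (3 - 2 * σ) +
        n ^ (6 / 5 : ℝ) * X ^ 2 * n ^ (3 / 2 - σ) +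
        (n ^ (6 / 5 : ℝ)) ^ (9 / 8 : ℝ) * X ^ (29 / 16 : ℝ) * n ^ (3 / 2 - σ)) →
      X ≤ C * n ^ δ * (n ^ (6 / 5 : ℝ) * n ^ ((12 - 20 * σ) / 5)) := by
  set K : ℝ := 4 * C₀ ^ 3 * (1 + C₁) with hK
  have hK0 : 0 ≤ K := by positivity
  refine ⟨8 * max 1 (8 * K), by positivity, ?_⟩
  intro σ n δ X S hσ1 hσ2 hn hδ hX hS0 h0 hS
  have hn0 : 0 < n := by linarith
  -- the exponents and the powers of `X`
  set E : ℝ := (18 - 20 * σ) / 5 with hE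
  let e : Fin 8 → ℝ := ![6 - 6 * σ, 5 - 6 * σ, 26 / 5 - 6 * σ, 103 / 20 - 6 * σ, 27 / 5 - 6 * σ,
    36 / 5 - 8 * σ, 57 / 10 - 7 * σ, 117 / 20 - 7 * σ]
  let a : Fin 8 → ℝ := ![0, 2, 7 / 4, 29 / 16, 3 / 2, 1, 2, 29 / 16]
  have hcheck : ∀ i : Fin 8, 1 ≤ 3 - a i ∧ e i / (3 - a i) ≤ E := by
    intro i
    fin_cases i <;> simp only [e, a, hE] <;> constructor <;> (try norm_num) <;> linarith
  -- Step 1: cube Proposition 4.6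
  have hcube : X ^ 3 ≤ 4 * C₀ ^ 3 * n ^ (6 - 6 * σ) + 4 * C₀ ^ 3 * (n ^ (3 - 6 * σ) * S) := by
    set A : ℝ := n ^ (2 - 2 * σ) with hA
    set B : ℝ := n ^ (1 - 2 * σ) * S ^ (1 / 3 : ℝ) with hB
    have hA0 : 0 ≤ A := by positivity
    have hB0 : 0 ≤ B := by positivity
    have h1 : X ^ 3 ≤ (C₀ * (A + B)) ^ 3 := pow_le_pow_left₀ hX h0 3
    have h2 : (A + B) ^ 3 ≤ 4 * (A ^ 3 + B ^ 3) := by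
      nlinarith [mul_nonneg (mul_nonneg hA0 hB0) (add_nonneg hA0 hB0), sq_nonneg (A - B),
        mul_nonneg (sq_nonneg (A - B)) (add_nonneg hA0 hB0)]
    have hA3 : A ^ 3 = n ^ (6 - 6 * σ) := by
      rw [hA, ← Real.rpow_natCast, ← Real.rpow_mul hn0.le]; ring_nf
    have hB3 : B ^ 3 = n ^ (3 - 6 * σ) * S := by
      rw [hB, mul_pow, ← Real.rpow_natCast (n ^ (1 - 2 * σ)), ← Real.rpow_mul hn0.le,
        ← Real.rpow_natCast (S ^ (1 / 3 : ℝ)), ← Real.rpow_mul hS0]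
      norm_num
      left; ring_nf
    calc X ^ 3 ≤ (C₀ * (A + B)) ^ 3 := h1
      _ = C₀ ^ 3 * (A + B) ^ 3 := by ring
      _ ≤ C₀ ^ 3 * (4 * (A ^ 3 + B ^ 3)) := by gcongr
      _ = _ := by rw [hA3, hB3]; ring
  -- Step 2: the eight terms
  have hpow : ∀ x y : ℝ, n ^ (x + y) = n ^ x * n ^ y := fun x y ↦ Real.rpow_add hn0 x y
  have hT18 : (n ^ (6 / 5 : ℝ)) ^ (1 / 8 : ℝ) = n ^ (3 / 20 : ℝ) := by
    rw [← Real.rpow_mul hn0.le]; norm_num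
  have hT2 : (n ^ (6 / 5 : ℝ)) ^ 2 = n ^ (12 / 5 : ℝ) := by
    rw [← Real.rpow_natCast, ← Real.rpow_mul hn0.le]; norm_num
  have hT98 : (n ^ (6 / 5 : ℝ)) ^ (9 / 8 : ℝ) = n ^ (27 / 20 : ℝ) := by
    rw [← Real.rpow_mul hn0.le]; norm_num
  have hn2 : n ^ 2 = n ^ (2 : ℝ) := (Real.rpow_two n).symm
  have hn1 : n = n ^ (1 : ℝ) := (Real.rpow_one n).symm
  have hX2 : X ^ 2 = X ^ (2 : ℝ) := (Real.rpow_two X).symm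
  have hX1 : X = X ^ (1 : ℝ) := (Real.rpow_one X).symm
  have hX0' : X ^ (0 : ℝ) = 1 := Real.rpow_zero X
  have hc : 4 * C₀ ^ 3 * C₁ ≤ K := by rw [hK]; nlinarith [pow_nonneg hC₀ 3]
  have hc' : 4 * C₀ ^ 3 ≤ K := by rw [hK]; nlinarith [pow_nonneg hC₀ 3]
  -- term 0
  have P0 : 4 * C₀ ^ 3 * n ^ (6 - 6 * σ) ≤ K * n ^ (e 0 + δ) * X ^ (a 0) := by
    have h1 : n ^ (6 - 6 * σ) ≤ n ^ (e 0 + δ) :=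
      Real.rpow_le_rpow_of_exponent_le hn (by simp [e]; exact hδ)
    simp only [a, Matrix.cons_val_zero, hX0', mul_one]
    exact mul_le_mul hc' h1 (by positivity) hK0
  -- the generic shape of terms 1–7
  have Pgen : ∀ (i : Fin 8) (Tm : ℝ), 0 ≤ Tm → n ^ (3 - 6 * σ) * (n ^ δ * Tm) = n ^ (e i + δ) * X ^ (a i) →
      4 * C₀ ^ 3 * (n ^ (3 - 6 * σ) * (C₁ * n ^ δ * Tm)) ≤ K * n ^ (e i + δ) * X ^ (a i) := by
    intro i Tm hTm hEq
    have : 4 * C₀ ^ 3 * (n ^ (3 - 6 * σ) * (C₁ * n ^ δ * Tm)) =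
        (4 * C₀ ^ 3 * C₁) * (n ^ (3 - 6 * σ) * (n ^ δ * Tm)) := by ring
    rw [this, hEq, mul_assoc K]
    exact mul_le_mul_of_nonneg_right hc (by positivity)
  have P1 := Pgen 1 (n ^ 2 * X ^ 2) (by positivity) (by
    simp only [e, a, Matrix.cons_val_one, Matrix.cons_val_zero]
    rw [hn2, hX2, show 5 - 6 * σ + δ = (3 - 6 * σ) + (δ + 2) by ring, hpow, hpow]; ring)
  have P2 := Pgen 2 (n ^ (6 / 5 : ℝ) * n * X ^ (7 / 4 : ℝ)) (by positivity) (by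
    simp only [e, a, Matrix.cons_val]
    rw [show 26 / 5 - 6 * σ + δ = (3 - 6 * σ) + (δ + (6 / 5 + 1)) by ring, hpow, hpow, hpow,
      Real.rpow_one]; ring)
  have P3 := Pgen 3 (n ^ 2 * (n ^ (6 / 5 : ℝ)) ^ (1 / 8 : ℝ) * X ^ (29 / 16 : ℝ)) (by positivity) (by
    simp only [e, a, Matrix.cons_val]
    rw [hT18, hn2, show 103 / 20 - 6 * σ + δ = (3 - 6 * σ) + (δ + (2 + 3 / 20)) by ring, hpow, hpow,
      hpow]; ring)
  have P4 := Pgen 4 ((n ^ (6 / 5 : ℝ)) ^ 2 * X ^ (3 / 2 : ℝ)) (by positivity) (by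
    simp only [e, a, Matrix.cons_val]
    rw [hT2, show 27 / 5 - 6 * σ + δ = (3 - 6 * σ) + (δ + 12 / 5) by ring, hpow, hpow]; ring)
  have P5 := Pgen 5 (n ^ (6 / 5 : ℝ) * X * n ^ (3 - 2 * σ)) (by positivity) (by
    simp only [e, a, Matrix.cons_val]
    rw [show 36 / 5 - 8 * σ + δ = (3 - 6 * σ) + (δ + (6 / 5 + (3 - 2 * σ))) by ring, hpow, hpow,
      hpow, ← hX1]; ring)
  have P6 := Pgen 6 (n ^ (6 / 5 : ℝ) * X ^ 2 * n ^ (3 / 2 - σ)) (by positivity) (by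
    simp only [e, a, Matrix.cons_val]
    rw [hX2, show 57 / 10 - 7 * σ + δ = (3 - 6 * σ) + (δ + (6 / 5 + (3 / 2 - σ))) by ring, hpow,
      hpow, hpow]; ring)
  have P7 := Pgen 7 ((n ^ (6 / 5 : ℝ)) ^ (9 / 8 : ℝ) * X ^ (29 / 16 : ℝ) * n ^ (3 / 2 - σ))
    (by positivity) (by
    simp only [e, a, Matrix.cons_val]
    rw [hT98, show 117 / 20 - 7 * σ + δ = (3 - 6 * σ) + (δ + (27 / 20 + (3 / 2 - σ))) by ring,
      hpow, hpow, hpow]; ring)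
  have hsum : X ^ 3 ≤ ∑ i : Fin 8, K * n ^ (e i + δ) * X ^ (a i) := by
    rw [Fin.sum_univ_eight]
    have hS' : 4 * C₀ ^ 3 * (n ^ (3 - 6 * σ) * S) ≤ 4 * C₀ ^ 3 * (n ^ (3 - 6 * σ) *
        (C₁ * n ^ δ * (n ^ 2 * X ^ 2 + n ^ (6 / 5 : ℝ) * n * X ^ (7 / 4 : ℝ) +
        n ^ 2 * (n ^ (6 / 5 : ℝ)) ^ (1 / 8 : ℝ) * X ^ (29 / 16 : ℝ) +
        (n ^ (6 / 5 : ℝ)) ^ 2 * X ^ (3 / 2 : ℝ) + n ^ (6 / 5 : ℝ) * X * n ^ (3 - 2 * σ) +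
        n ^ (6 / 5 : ℝ) * X ^ 2 * n ^ (3 / 2 - σ) +
        (n ^ (6 / 5 : ℝ)) ^ (9 / 8 : ℝ) * X ^ (29 / 16 : ℝ) * n ^ (3 / 2 - σ)))) := by
      gcongr
    linarith [hcube, hS', P0, P1, P2, P3, P4, P5, P6, P7]
  -- Step 3: solve for `X`
  have hle := le_sum_rpow_of_cube_le (Finset.univ : Finset (Fin 8)) (fun i ↦ K * n ^ (e i + δ)) a
    (fun i _ ↦ by positivity) (fun i _ ↦ by linarith [(hcheck i).1]) hsum
  simp only [Finset.card_univ, Fintype.card_fin, Nat.cast_ofNat] at hle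
  have hterm : ∀ i : Fin 8, ((8 : ℝ) * (K * n ^ (e i + δ))) ^ (1 / (3 - a i)) ≤
      max 1 (8 * K) * n ^ (E + δ) := by
    intro i
    rw [← mul_assoc]
    exact rpow_term_le (by positivity) (hcheck i).1 (hcheck i).2 hn hδ
  have hfinal : X ≤ 8 * (max 1 (8 * K) * n ^ (E + δ)) := by
    refine hle.trans ?_
    calc ∑ i : Fin 8, ((8 : ℝ) * (K * n ^ (e i + δ))) ^ (1 / (3 - a i))
        ≤ ∑ _i : Fin 8, max 1 (8 * K) * n ^ (E + δ) := Finset.sum_le_sum fun i _ ↦ hterm i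
      _ = 8 * (max 1 (8 * K) * n ^ (E + δ)) := by
          rw [Finset.sum_const, Finset.card_univ, Fintype.card_fin, nsmul_eq_mul]; norm_num
  have hEeq : n ^ (E + δ) = n ^ δ * (n ^ (6 / 5 : ℝ) * n ^ ((12 - 20 * σ) / 5)) := by
    rw [← hpow, ← hpow, hE]; ring_nf
  rw [hEeq] at hfinal
  linarith

/-- `(u₁ + u₂ + u₃)^{1/2} ≤ u₁^{1/2} + u₂^{1/2} + u₃^{1/2}`. [folklore] -/
theorem rpow_half_add_three_le {u₁ u₂ u₃ : ℝ} (h₁ : 0 ≤ u₁) (h₂ : 0 ≤ u₂) (h₃ : 0 ≤ u₃) :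
    (u₁ + u₂ + u₃) ^ (1 / 2 : ℝ) ≤ u₁ ^ (1 / 2 : ℝ) + u₂ ^ (1 / 2 : ℝ) + u₃ ^ (1 / 2 : ℝ) := by
  calc (u₁ + u₂ + u₃) ^ (1 / 2 : ℝ) ≤ (u₁ + u₂) ^ (1 / 2 : ℝ) + u₃ ^ (1 / 2 : ℝ) :=
        Real.rpow_add_le_add_rpow (by positivity) h₃ (by norm_num) (by norm_num)
    _ ≤ u₁ ^ (1 / 2 : ℝ) + u₂ ^ (1 / 2 : ℝ) + u₃ ^ (1 / 2 : ℝ) := by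
        gcongr
        exact Real.rpow_add_le_add_rpow h₁ h₂ (by norm_num) (by norm_num)

set_option maxHeartbeats 1000000 in
/-- **Proposition 11.2 (`S₃` bound) from Propositions 10.1 and 11.1, numerically, added to the
`S₂` bound (Proposition 6.1 with `k = 4`)**: with `T = n^{6/5}`,
`S₂ ≪ n^{δ}(n²X² + TnX^{7/4} + n²T^{1/8}X^{29/16})`, `S₃ ≪ n^{δ}(T²X^{3/2} + TnX^{1/2}E^{1/2})` and
`E ≪ n^{δ}(Xn^{4−4σ} + X^{21/8}T^{1/4}n^{1−2σ} + X³n^{1−2σ})` give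
`S₂ + S₃ ≪ n^{2δ}(n²X² + TnX^{7/4} + n²T^{1/8}X^{29/16} + T²X^{3/2} + TXn^{3−2σ} + TX²n^{3/2−σ} + T^{9/8}X^{29/16}n^{3/2−σ})`
("An immediate consequence of Proposition 11.1 is a good bound for the key term `S₃` by substituting
the bound of Proposition 11.1 (applied to `D_N(t)`) into Proposition 10.1.")
[cite: GuthMaynard2026, Proposition 11.2 and Section 12] -/
theorem S2_add_S3_numeric {C₂ C₃ C₄ n δ σ X E S₂ S₃ : ℝ} (hC₂ : 0 ≤ C₂) (hC₃ : 0 ≤ C₃) (hC₄ : 0 ≤ C₄)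
    (hn : 1 ≤ n) (hδ : 0 ≤ δ) (hX : 0 ≤ X) (hE : 0 ≤ E)
    (hS₂ : S₂ ≤ C₂ * n ^ δ * (n ^ 2 * X ^ 2 + n ^ (6 / 5 : ℝ) * n * X ^ (7 / 4 : ℝ) +
      n ^ 2 * (n ^ (6 / 5 : ℝ)) ^ (1 / 8 : ℝ) * X ^ (29 / 16 : ℝ)))
    (hS₃ : S₃ ≤ C₃ * n ^ δ * ((n ^ (6 / 5 : ℝ)) ^ 2 * X ^ (3 / 2 : ℝ) +
      n ^ (6 / 5 : ℝ) * n * X ^ (1 / 2 : ℝ) * E ^ (1 / 2 : ℝ)))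
    (hEn : E ≤ C₄ * n ^ δ * (X * n ^ (4 - 4 * σ) +
      X ^ (21 / 8 : ℝ) * (n ^ (6 / 5 : ℝ)) ^ (1 / 4 : ℝ) * n ^ (1 - 2 * σ) + X ^ 3 * n ^ (1 - 2 * σ))) :
    S₂ + S₃ ≤ (C₂ + C₃ * (1 + C₄ ^ (1 / 2 : ℝ))) * n ^ (2 * δ) *
      (n ^ 2 * X ^ 2 + n ^ (6 / 5 : ℝ) * n * X ^ (7 / 4 : ℝ) +
        n ^ 2 * (n ^ (6 / 5 : ℝ)) ^ (1 / 8 : ℝ) * X ^ (29 / 16 : ℝ) +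
        (n ^ (6 / 5 : ℝ)) ^ 2 * X ^ (3 / 2 : ℝ) + n ^ (6 / 5 : ℝ) * X * n ^ (3 - 2 * σ) +
        n ^ (6 / 5 : ℝ) * X ^ 2 * n ^ (3 / 2 - σ) +
        (n ^ (6 / 5 : ℝ)) ^ (9 / 8 : ℝ) * X ^ (29 / 16 : ℝ) * n ^ (3 / 2 - σ)) := by
  have hn0 : 0 < n := by linarith
  set T : ℝ := n ^ (6 / 5 : ℝ) with hT
  have hT0 : 0 < T := by positivity
  -- names for the seven terms
  set t₁ : ℝ := n ^ 2 * X ^ 2 with ht₁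
  set t₂ : ℝ := T * n * X ^ (7 / 4 : ℝ) with ht₂
  set t₃ : ℝ := n ^ 2 * T ^ (1 / 8 : ℝ) * X ^ (29 / 16 : ℝ) with ht₃
  set t₄ : ℝ := T ^ 2 * X ^ (3 / 2 : ℝ) with ht₄
  set t₅ : ℝ := T * X * n ^ (3 - 2 * σ) with ht₅
  set t₆ : ℝ := T * X ^ 2 * n ^ (3 / 2 - σ) with ht₆
  set t₇ : ℝ := T ^ (9 / 8 : ℝ) * X ^ (29 / 16 : ℝ) * n ^ (3 / 2 - σ) with ht₇
  have h₁ : 0 ≤ t₁ := by positivity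
  have h₂ : 0 ≤ t₂ := by positivity
  have h₃ : 0 ≤ t₃ := by positivity
  have h₄ : 0 ≤ t₄ := by positivity
  have h₅ : 0 ≤ t₅ := by positivity
  have h₆ : 0 ≤ t₆ := by positivity
  have h₇ : 0 ≤ t₇ := by positivity
  -- `n^δ ≤ n^{2δ}`, `n^{δ/2} n^δ ≤ n^{2δ}`
  have hnδ : n ^ δ ≤ n ^ (2 * δ) := Real.rpow_le_rpow_of_exponent_le hn (by linarith)
  have hnδ' : n ^ δ * n ^ (δ * (1 / 2)) ≤ n ^ (2 * δ) := by
    rw [← Real.rpow_add hn0]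
    exact Real.rpow_le_rpow_of_exponent_le hn (by linarith)
  have hn2δ : 0 ≤ n ^ (2 * δ) := by positivity
  -- the energy substitution: `E^{1/2} ≤ C₄^{1/2} n^{δ/2} (u₁^{1/2} + u₂^{1/2} + u₃^{1/2})`
  set u₁ : ℝ := X * n ^ (4 - 4 * σ) with hu₁
  set u₂ : ℝ := X ^ (21 / 8 : ℝ) * T ^ (1 / 4 : ℝ) * n ^ (1 - 2 * σ) with hu₂
  set u₃ : ℝ := X ^ 3 * n ^ (1 - 2 * σ) with hu₃
  have hu₁0 : 0 ≤ u₁ := by positivity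
  have hu₂0 : 0 ≤ u₂ := by positivity
  have hu₃0 : 0 ≤ u₃ := by positivity
  have hE12 : E ^ (1 / 2 : ℝ) ≤ C₄ ^ (1 / 2 : ℝ) * n ^ (δ * (1 / 2)) *
      (u₁ ^ (1 / 2 : ℝ) + u₂ ^ (1 / 2 : ℝ) + u₃ ^ (1 / 2 : ℝ)) := by
    calc E ^ (1 / 2 : ℝ) ≤ (C₄ * n ^ δ * (u₁ + u₂ + u₃)) ^ (1 / 2 : ℝ) :=
          Real.rpow_le_rpow hE hEn (by norm_num)
      _ = C₄ ^ (1 / 2 : ℝ) * n ^ (δ * (1 / 2)) * (u₁ + u₂ + u₃) ^ (1 / 2 : ℝ) := by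
          rw [Real.mul_rpow (by positivity) (by positivity), Real.mul_rpow hC₄ (by positivity),
            ← Real.rpow_mul hn0.le]
      _ ≤ _ := by gcongr; exact rpow_half_add_three_le hu₁0 hu₂0 hu₃0
  -- the square roots of the `u_i`
  have hsq₁ : u₁ ^ (1 / 2 : ℝ) = X ^ (1 / 2 : ℝ) * n ^ (2 - 2 * σ) := by
    rw [hu₁, Real.mul_rpow hX (by positivity), ← Real.rpow_mul hn0.le]; ring_nf
  have hsq₂ : u₂ ^ (1 / 2 : ℝ) = X ^ (21 / 16 : ℝ) * T ^ (1 / 8 : ℝ) * n ^ (1 / 2 - σ) := by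
    rw [hu₂, Real.mul_rpow (by positivity) (by positivity), Real.mul_rpow (by positivity)
      (by positivity), ← Real.rpow_mul hX, ← Real.rpow_mul hT0.le (1 / 4) (1 / 2),
      ← Real.rpow_mul hn0.le (1 - 2 * σ) (1 / 2)]
    congr 1
    · congr 1 <;> norm_num
    · ring_nf
  have hsq₃ : u₃ ^ (1 / 2 : ℝ) = X ^ (3 / 2 : ℝ) * n ^ (1 / 2 - σ) := by
    rw [hu₃, Real.mul_rpow (by positivity) (by positivity), ← Real.rpow_natCast X 3,
      ← Real.rpow_mul hX, ← Real.rpow_mul hn0.le]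
    norm_num; left; ring_nf
  -- the products `T n X^{1/2} u_i^{1/2}`
  have hXX : X ^ (1 / 2 : ℝ) * X ^ (1 / 2 : ℝ) = X := by
    rw [← Real.rpow_add' hX (by norm_num)]; norm_num
  have hX2116 : X ^ (1 / 2 : ℝ) * X ^ (21 / 16 : ℝ) = X ^ (29 / 16 : ℝ) := by
    rw [← Real.rpow_add' hX (by norm_num)]; norm_num
  have hX32 : X ^ (1 / 2 : ℝ) * X ^ (3 / 2 : ℝ) = X ^ 2 := by
    rw [← Real.rpow_add' hX (by norm_num)]; norm_num
  have hp₁ : T * n * X ^ (1 / 2 : ℝ) * u₁ ^ (1 / 2 : ℝ) = t₅ := by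
    rw [hsq₁, ht₅]
    have : n * n ^ (2 - 2 * σ) = n ^ (3 - 2 * σ) := by
      rw [show (3 : ℝ) - 2 * σ = (2 - 2 * σ) + 1 by ring, Real.rpow_add_one hn0.ne']; ring
    calc T * n * X ^ (1 / 2 : ℝ) * (X ^ (1 / 2 : ℝ) * n ^ (2 - 2 * σ))
        = T * (X ^ (1 / 2 : ℝ) * X ^ (1 / 2 : ℝ)) * (n * n ^ (2 - 2 * σ)) := by ring
      _ = T * X * n ^ (3 - 2 * σ) := by rw [hXX, this]
  have hp₂ : T * n * X ^ (1 / 2 : ℝ) * u₂ ^ (1 / 2 : ℝ) = t₇ := by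
    rw [hsq₂, ht₇]
    have e1 : n * n ^ (1 / 2 - σ) = n ^ (3 / 2 - σ) := by
      rw [show (3 : ℝ) / 2 - σ = (1 / 2 - σ) + 1 by ring, Real.rpow_add_one hn0.ne']; ring
    have e2 : T * T ^ (1 / 8 : ℝ) = T ^ (9 / 8 : ℝ) := by
      rw [show (9 : ℝ) / 8 = 1 / 8 + 1 by norm_num, Real.rpow_add_one hT0.ne']; ring
    calc T * n * X ^ (1 / 2 : ℝ) * (X ^ (21 / 16 : ℝ) * T ^ (1 / 8 : ℝ) * n ^ (1 / 2 - σ))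
        = (T * T ^ (1 / 8 : ℝ)) * (X ^ (1 / 2 : ℝ) * X ^ (21 / 16 : ℝ)) * (n * n ^ (1 / 2 - σ)) := by
          ring
      _ = T ^ (9 / 8 : ℝ) * X ^ (29 / 16 : ℝ) * n ^ (3 / 2 - σ) := by rw [e2, hX2116, e1]
  have hp₃ : T * n * X ^ (1 / 2 : ℝ) * u₃ ^ (1 / 2 : ℝ) = t₆ := by
    rw [hsq₃, ht₆]
    have e1 : n * n ^ (1 / 2 - σ) = n ^ (3 / 2 - σ) := by
      rw [show (3 : ℝ) / 2 - σ = (1 / 2 - σ) + 1 by ring, Real.rpow_add_one hn0.ne']; ring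
    calc T * n * X ^ (1 / 2 : ℝ) * (X ^ (3 / 2 : ℝ) * n ^ (1 / 2 - σ))
        = T * (X ^ (1 / 2 : ℝ) * X ^ (3 / 2 : ℝ)) * (n * n ^ (1 / 2 - σ)) := by ring
      _ = T * X ^ 2 * n ^ (3 / 2 - σ) := by rw [hX32, e1]
  -- assemble the `S₃` bound
  have hS₃' : S₃ ≤ C₃ * (1 + C₄ ^ (1 / 2 : ℝ)) * n ^ (2 * δ) * (t₄ + t₅ + t₆ + t₇) := by
    have h1 : T * n * X ^ (1 / 2 : ℝ) * E ^ (1 / 2 : ℝ) ≤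
        C₄ ^ (1 / 2 : ℝ) * n ^ (δ * (1 / 2)) * (t₅ + t₇ + t₆) := by
      calc T * n * X ^ (1 / 2 : ℝ) * E ^ (1 / 2 : ℝ)
          ≤ T * n * X ^ (1 / 2 : ℝ) * (C₄ ^ (1 / 2 : ℝ) * n ^ (δ * (1 / 2)) *
            (u₁ ^ (1 / 2 : ℝ) + u₂ ^ (1 / 2 : ℝ) + u₃ ^ (1 / 2 : ℝ))) := by gcongr
        _ = C₄ ^ (1 / 2 : ℝ) * n ^ (δ * (1 / 2)) * (T * n * X ^ (1 / 2 : ℝ) * u₁ ^ (1 / 2 : ℝ) +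
            T * n * X ^ (1 / 2 : ℝ) * u₂ ^ (1 / 2 : ℝ) + T * n * X ^ (1 / 2 : ℝ) * u₃ ^ (1 / 2 : ℝ)) := by
            ring
        _ = C₄ ^ (1 / 2 : ℝ) * n ^ (δ * (1 / 2)) * (t₅ + t₇ + t₆) := by rw [hp₁, hp₂, hp₃]
    have hC412 : 0 ≤ C₄ ^ (1 / 2 : ℝ) := by positivity
    calc S₃ ≤ C₃ * n ^ δ * (t₄ + T * n * X ^ (1 / 2 : ℝ) * E ^ (1 / 2 : ℝ)) := hS₃
      _ ≤ C₃ * n ^ δ * (t₄ + C₄ ^ (1 / 2 : ℝ) * n ^ (δ * (1 / 2)) * (t₅ + t₇ + t₆)) := by gcongr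
      _ = C₃ * (n ^ δ * t₄) + C₃ * C₄ ^ (1 / 2 : ℝ) * (n ^ δ * n ^ (δ * (1 / 2))) * (t₅ + t₇ + t₆) := by
          ring
      _ ≤ C₃ * (n ^ (2 * δ) * t₄) + C₃ * C₄ ^ (1 / 2 : ℝ) * n ^ (2 * δ) * (t₅ + t₇ + t₆) := by
          gcongr
      _ ≤ C₃ * (1 + C₄ ^ (1 / 2 : ℝ)) * n ^ (2 * δ) * (t₄ + t₅ + t₆ + t₇) := by
          have e : C₃ * (1 + C₄ ^ (1 / 2 : ℝ)) * n ^ (2 * δ) * (t₄ + t₅ + t₆ + t₇) -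
              (C₃ * (n ^ (2 * δ) * t₄) + C₃ * C₄ ^ (1 / 2 : ℝ) * n ^ (2 * δ) * (t₅ + t₇ + t₆)) =
              C₃ * n ^ (2 * δ) * (t₅ + t₆ + t₇) + C₃ * C₄ ^ (1 / 2 : ℝ) * n ^ (2 * δ) * t₄ := by
            ring
          have : 0 ≤ C₃ * n ^ (2 * δ) * (t₅ + t₆ + t₇) + C₃ * C₄ ^ (1 / 2 : ℝ) * n ^ (2 * δ) * t₄ := by
            positivity
          linarith
  have hS₂' : S₂ ≤ C₂ * n ^ (2 * δ) * (t₁ + t₂ + t₃) := by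
    calc S₂ ≤ C₂ * n ^ δ * (t₁ + t₂ + t₃) := hS₂
      _ ≤ C₂ * n ^ (2 * δ) * (t₁ + t₂ + t₃) := by gcongr
  have hsum0 : 0 ≤ t₁ + t₂ + t₃ + t₄ + t₅ + t₆ + t₇ := by positivity
  have hC34 : 0 ≤ C₃ * (1 + C₄ ^ (1 / 2 : ℝ)) := by positivity
  calc S₂ + S₃ ≤ C₂ * n ^ (2 * δ) * (t₁ + t₂ + t₃) +
        C₃ * (1 + C₄ ^ (1 / 2 : ℝ)) * n ^ (2 * δ) * (t₄ + t₅ + t₆ + t₇) := add_le_add hS₂' hS₃'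
    _ ≤ C₂ * n ^ (2 * δ) * (t₁ + t₂ + t₃ + t₄ + t₅ + t₆ + t₇) +
        C₃ * (1 + C₄ ^ (1 / 2 : ℝ)) * n ^ (2 * δ) * (t₁ + t₂ + t₃ + t₄ + t₅ + t₆ + t₇) :=
          add_le_add (mul_le_mul_of_nonneg_left (by linarith) (by positivity))
            (mul_le_mul_of_nonneg_left (by linarith) (by positivity))
    _ = (C₂ + C₃ * (1 + C₄ ^ (1 / 2 : ℝ))) * n ^ (2 * δ) * (t₁ + t₂ + t₃ + t₄ + t₅ + t₆ + t₇) := by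
          ring


/-! ## The assembly: Proposition 3.1 and `zeroDensity_guth_maynard` from the bounds for `S₂`, `S₃`, `E(W)` -/

open GuthMaynardFourier Complex

/-- The additive energy `E(W) := #{(t₁,t₂,t₃,t₄) ∈ W⁴ : |t₁ + t₂ − t₃ − t₄| ≤ 1}` of a finite set of
reals. [cite: GuthMaynard2026, (2.3) and Section 11] -/
def addEnergy (W : Finset ℝ) : ℝ :=
  (((W ×ˢ W) ×ˢ (W ×ˢ W)).filter
    (fun q : (ℝ × ℝ) × (ℝ × ℝ) ↦ |q.1.1 + q.1.2 - q.2.1 - q.2.2| ≤ 1)).card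

/-- `E(W) ≥ 0`. [folklore] -/
theorem addEnergy_nonneg (W : Finset ℝ) : 0 ≤ addEnergy W := by
  unfold addEnergy; positivity

/-- **A weight as in §3 of the paper exists**: a smooth `w : ℝ → [0,1]` supported in `[1,2]` and
equal to `1` on `[6/5, 9/5]` (Mathlib's `ContDiffBump` centred at `3/2` with radii `3/10 < 1/2`).
[cite: GuthMaynard2026, Section 3] -/
theorem exists_weight : ∃ w : ℝ → ℝ, ContDiff ℝ ∞ w ∧ Function.support w ⊆ Set.Icc 1 2 ∧
    (∀ u : ℝ, 6 / 5 ≤ u → u ≤ 9 / 5 → w u = 1) ∧ (∀ u, 0 ≤ w u ∧ w u ≤ 1) := by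
  let f : ContDiffBump (3 / 2 : ℝ) := ⟨3 / 10, 1 / 2, by norm_num, by norm_num⟩
  refine ⟨f, f.contDiff, ?_, ?_, fun u ↦ ⟨f.nonneg, f.le_one⟩⟩
  · rw [f.support_eq]
    intro u hu
    rw [Metric.mem_ball, Real.dist_eq] at hu
    have hu' : |u - 3 / 2| < 1 / 2 := hu
    rw [abs_lt] at hu'
    constructor <;> linarith [hu'.1, hu'.2]
  · intro u h1 h2
    apply f.one_of_mem_closedBall
    rw [Metric.mem_closedBall, Real.dist_eq]
    show |u - 3 / 2| ≤ 3 / 10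
    rw [abs_le]
    constructor <;> linarith

set_option maxHeartbeats 1000000 in
/-- **Proposition 3.1 from the bounds for `S₂`, `S₃` and the energy (§12 of the paper).** Let `w` be
smooth, supported in `[1,2]`, with `|w| ≤ 1`. Assume, in the setting of Proposition 3.1
(`W` in an interval of length `T = N^{6/5}`, `T^ε`-separated, all `N ≥ N₀(ε, δ)`, `T^δ`-losses):
Proposition 6.1 with `k = 4` (`hS2`: `|S₂| ⪅ N²|W|² + TN|W|^{7/4} + N²|W|^{29/16}T^{1/8}`),
Proposition 10.1 (`hS3`: `|S₃| ⪅ T²|W|^{3/2} + TN|W|^{1/2}E(W)^{1/2}`) and Proposition 11.1 for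
`T = N^{6/5}`, `σ ∈ [7/10, 4/5]` (`hE`: `E(W) ⪅ |W|N^{4−4σ} + |W|^{21/8}T^{1/4}N^{1−2σ} + |W|³N^{1−2σ}`
whenever `|∑_n a_n n^{it}| ≥ N^σ` on a `1`-separated `W` with `|a_n| ≤ 1`). Then Proposition 3.1
holds for `w` (hypothesis `hKP` of `zeroDensity_guth_maynard_of_keyProp`): Proposition 4.6 and 5.1
(`card_le_keyProp_setting`), Proposition 11.2 (`S2_add_S3_numeric`, applied with `a_n = w(n/N)b_n`)
and the optimisation of §12 (`keyProp_optimisation`).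
[cite: GuthMaynard2026, Section 12, proof of Proposition 3.1] -/
theorem keyProp_of_bounds {w : ℝ → ℝ} (hw : ContDiff ℝ ∞ w)
    (hsupp : Function.support w ⊆ Set.Icc 1 2) (hwb : ∀ u, |w u| ≤ 1)
    (hS2 : ∀ ε : ℝ, 0 < ε → ∀ δ : ℝ, 0 < δ → ∃ C N₀ : ℝ, ∀ N : ℕ, N₀ ≤ (N : ℝ) →
      ∀ (t₀ : ℝ) (W : Finset ℝ), (∀ t ∈ W, t₀ ≤ t ∧ t ≤ t₀ + (N : ℝ) ^ (6 / 5 : ℝ)) →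
      (∀ t ∈ W, ∀ t' ∈ W, t ≠ t' → ((N : ℝ) ^ (6 / 5 : ℝ)) ^ ε ≤ |t - t'|) →
      ‖S2 w N W‖ ≤ C * (N : ℝ) ^ δ * ((N : ℝ) ^ 2 * (W.card : ℝ) ^ 2 +
        (N : ℝ) ^ (6 / 5 : ℝ) * N * (W.card : ℝ) ^ (7 / 4 : ℝ) +
        (N : ℝ) ^ 2 * ((N : ℝ) ^ (6 / 5 : ℝ)) ^ (1 / 8 : ℝ) * (W.card : ℝ) ^ (29 / 16 : ℝ)))
    (hS3 : ∀ ε : ℝ, 0 < ε → ∀ δ : ℝ, 0 < δ → ∃ C N₀ : ℝ, ∀ N : ℕ, N₀ ≤ (N : ℝ) →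
      ∀ (t₀ : ℝ) (W : Finset ℝ), (∀ t ∈ W, t₀ ≤ t ∧ t ≤ t₀ + (N : ℝ) ^ (6 / 5 : ℝ)) →
      (∀ t ∈ W, ∀ t' ∈ W, t ≠ t' → ((N : ℝ) ^ (6 / 5 : ℝ)) ^ ε ≤ |t - t'|) →
      ‖S3 w N W‖ ≤ C * (N : ℝ) ^ δ * (((N : ℝ) ^ (6 / 5 : ℝ)) ^ 2 * (W.card : ℝ) ^ (3 / 2 : ℝ) +
        (N : ℝ) ^ (6 / 5 : ℝ) * N * (W.card : ℝ) ^ (1 / 2 : ℝ) * (addEnergy W) ^ (1 / 2 : ℝ)))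
    (hE : ∀ σ : ℝ, 7 / 10 ≤ σ → σ ≤ 4 / 5 → ∀ δ : ℝ, 0 < δ → ∃ C N₀ : ℝ, ∀ N : ℕ, N₀ ≤ (N : ℝ) →
      ∀ (a : ℕ → ℂ) (t₀ : ℝ) (W : Finset ℝ), (∀ n, ‖a n‖ ≤ 1) →
      (∀ t ∈ W, t₀ ≤ t ∧ t ≤ t₀ + (N : ℝ) ^ (6 / 5 : ℝ)) →
      (∀ t ∈ W, ∀ t' ∈ W, t ≠ t' → 1 ≤ |t - t'|) →
      (∀ t ∈ W, (N : ℝ) ^ σ ≤ ‖∑ n ∈ Finset.Icc N (2 * N), a n * (n : ℂ) ^ ((t : ℂ) * I)‖) →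
      addEnergy W ≤ C * (N : ℝ) ^ δ * ((W.card : ℝ) * (N : ℝ) ^ (4 - 4 * σ) +
        (W.card : ℝ) ^ (21 / 8 : ℝ) * ((N : ℝ) ^ (6 / 5 : ℝ)) ^ (1 / 4 : ℝ) * (N : ℝ) ^ (1 - 2 * σ) +
        (W.card : ℝ) ^ 3 * (N : ℝ) ^ (1 - 2 * σ))) :
    ∀ σ : ℝ, 7 / 10 ≤ σ → σ ≤ 4 / 5 → ∀ ε : ℝ, 0 < ε → ∀ δ : ℝ, 0 < δ →
      ∃ C N₀ : ℝ, ∀ N : ℕ, N₀ ≤ (N : ℝ) → ∀ (b : ℕ → ℂ) (t₀ : ℝ) (W : Finset ℝ),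
      (∀ n, ‖b n‖ ≤ 1) → (∀ t ∈ W, t₀ ≤ t ∧ t ≤ t₀ + (N : ℝ) ^ (6 / 5 : ℝ)) →
      (∀ t ∈ W, ∀ t' ∈ W, t ≠ t' → ((N : ℝ) ^ (6 / 5 : ℝ)) ^ ε ≤ |t - t'|) →
      (∀ t ∈ W, (N : ℝ) ^ σ ≤ ‖∑ n ∈ Finset.Icc N (2 * N), ((w ((n : ℝ) / N) : ℝ) : ℂ) * b n *
        (n : ℂ) ^ ((t : ℂ) * I)‖) →
      (W.card : ℝ) ≤ C * (N : ℝ) ^ (6 / 5 : ℝ) * (N : ℝ) ^ ((12 - 20 * σ) / 5 + δ) := by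
  intro σ hσ1 hσ2 ε hε δ hδ
  obtain ⟨C₀, hC₀0, hC₀⟩ := card_le_keyProp_setting hw hsupp σ hε
  set δ' : ℝ := δ / 4 with hδ'
  have hδ'0 : 0 < δ' := by positivity
  obtain ⟨C₂, N₂, hC₂⟩ := hS2 ε hε δ' hδ'0
  obtain ⟨C₃, N₃, hC₃⟩ := hS3 ε hε δ' hδ'0
  obtain ⟨C₄, N₄, hC₄⟩ := hE σ hσ1 hσ2 δ' hδ'0
  set C₂' : ℝ := max C₂ 0 with hC₂'
  set C₃' : ℝ := max C₃ 0 with hC₃'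
  set C₄' : ℝ := max C₄ 0 with hC₄'
  obtain ⟨C, hC0, hC⟩ := keyProp_optimisation C₀ (C₂' + C₃' * (1 + C₄' ^ (1 / 2 : ℝ))) hC₀0
    (by positivity)
  refine ⟨C, max (max N₂ N₃) (max N₄ 1), fun N hN b t₀ W hb hW hsep hlarge ↦ ?_⟩
  have hN2 : N₂ ≤ N := le_trans ((le_max_left _ _).trans (le_max_left _ _)) hN
  have hN3 : N₃ ≤ N := le_trans ((le_max_right _ _).trans (le_max_left _ _)) hN
  have hN4 : N₄ ≤ N := le_trans ((le_max_left _ _).trans (le_max_right _ _)) hN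
  have hN1 : (1 : ℝ) ≤ N := le_trans ((le_max_right _ _).trans (le_max_right _ _)) hN
  have hN0 : (0 : ℝ) < N := by linarith
  have hNnat : 1 ≤ N := by exact_mod_cast hN1
  set n : ℝ := (N : ℝ) with hn
  set X : ℝ := (W.card : ℝ) with hX
  have hX0 : 0 ≤ X := by positivity
  set S : ℝ := ‖S2 w N W + S3 w N W‖ with hS
  have hS0 : 0 ≤ S := norm_nonneg _
  -- Proposition 4.6 / 5.1
  have h46 := hC₀ N hNnat b t₀ W hb hW hsep hlarge
  -- the bounds for `S₂`, `S₃`, `E`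
  have hsep1 : ∀ t ∈ W, ∀ t' ∈ W, t ≠ t' → 1 ≤ |t - t'| := by
    intro t ht t' ht' hne
    have h1 : (1 : ℝ) ≤ (n ^ (6 / 5 : ℝ)) ^ ε :=
      Real.one_le_rpow (Real.one_le_rpow hN1 (by norm_num)) hε.le
    exact h1.trans (hsep t ht t' ht' hne)
  have hb' : ∀ m, ‖(fun m : ℕ ↦ ((w ((m : ℝ) / N) : ℝ) : ℂ) * b m) m‖ ≤ 1 := by
    intro m
    simp only [norm_mul, Complex.norm_real, Real.norm_eq_abs]
    have := hwb ((m : ℝ) / N); have := hb m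
    nlinarith [abs_nonneg (w ((m : ℝ) / N)), norm_nonneg (b m)]
  have hEW := hC₄ N hN4 (fun m : ℕ ↦ ((w ((m : ℝ) / N) : ℝ) : ℂ) * b m) t₀ W hb' hW hsep1 hlarge
  have hS2W := hC₂ N hN2 t₀ W hW hsep
  have hS3W := hC₃ N hN3 t₀ W hW hsep
  -- replace the constants by nonnegative ones
  have hE0 := addEnergy_nonneg W
  have hS2' : ‖S2 w N W‖ ≤ C₂' * n ^ δ' * (n ^ 2 * X ^ 2 + n ^ (6 / 5 : ℝ) * n * X ^ (7 / 4 : ℝ) +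
      n ^ 2 * (n ^ (6 / 5 : ℝ)) ^ (1 / 8 : ℝ) * X ^ (29 / 16 : ℝ)) := by
    refine hS2W.trans ?_
    have : 0 ≤ n ^ δ' * (n ^ 2 * X ^ 2 + n ^ (6 / 5 : ℝ) * n * X ^ (7 / 4 : ℝ) +
      n ^ 2 * (n ^ (6 / 5 : ℝ)) ^ (1 / 8 : ℝ) * X ^ (29 / 16 : ℝ)) := by positivity
    nlinarith [le_max_left C₂ 0, this]
  have hS3' : ‖S3 w N W‖ ≤ C₃' * n ^ δ' * ((n ^ (6 / 5 : ℝ)) ^ 2 * X ^ (3 / 2 : ℝ) +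
      n ^ (6 / 5 : ℝ) * n * X ^ (1 / 2 : ℝ) * (addEnergy W) ^ (1 / 2 : ℝ)) := by
    refine hS3W.trans ?_
    have : 0 ≤ n ^ δ' * ((n ^ (6 / 5 : ℝ)) ^ 2 * X ^ (3 / 2 : ℝ) +
      n ^ (6 / 5 : ℝ) * n * X ^ (1 / 2 : ℝ) * (addEnergy W) ^ (1 / 2 : ℝ)) := by positivity
    nlinarith [le_max_left C₃ 0, this]
  have hE' : addEnergy W ≤ C₄' * n ^ δ' * (X * n ^ (4 - 4 * σ) +
      X ^ (21 / 8 : ℝ) * (n ^ (6 / 5 : ℝ)) ^ (1 / 4 : ℝ) * n ^ (1 - 2 * σ) + X ^ 3 * n ^ (1 - 2 * σ)) := by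
    refine hEW.trans ?_
    have : 0 ≤ n ^ δ' * (X * n ^ (4 - 4 * σ) +
      X ^ (21 / 8 : ℝ) * (n ^ (6 / 5 : ℝ)) ^ (1 / 4 : ℝ) * n ^ (1 - 2 * σ) + X ^ 3 * n ^ (1 - 2 * σ)) := by
      positivity
    nlinarith [le_max_left C₄ 0, this]
  -- Proposition 11.2 and the `S₂` bound, numerically
  have hnum := S2_add_S3_numeric (C₂ := C₂') (C₃ := C₃') (C₄ := C₄') (n := n) (δ := δ') (σ := σ)
    (X := X) (E := addEnergy W) (S₂ := ‖S2 w N W‖) (S₃ := ‖S3 w N W‖)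
    (le_max_right C₂ 0) (le_max_right C₃ 0) (le_max_right C₄ 0) hN1 hδ'0.le hX0 hE0 hS2' hS3' hE'
  have hSle : S ≤ (C₂' + C₃' * (1 + C₄' ^ (1 / 2 : ℝ))) * n ^ (2 * δ') *
      (n ^ 2 * X ^ 2 + n ^ (6 / 5 : ℝ) * n * X ^ (7 / 4 : ℝ) +
        n ^ 2 * (n ^ (6 / 5 : ℝ)) ^ (1 / 8 : ℝ) * X ^ (29 / 16 : ℝ) +
        (n ^ (6 / 5 : ℝ)) ^ 2 * X ^ (3 / 2 : ℝ) + n ^ (6 / 5 : ℝ) * X * n ^ (3 - 2 * σ) +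
        n ^ (6 / 5 : ℝ) * X ^ 2 * n ^ (3 / 2 - σ) +
        (n ^ (6 / 5 : ℝ)) ^ (9 / 8 : ℝ) * X ^ (29 / 16 : ℝ) * n ^ (3 / 2 - σ)) :=
    (norm_add_le _ _).trans hnum
  -- the optimisation of §12
  have hopt := hC σ n (2 * δ') X S hσ1 hσ2 hN1 (by positivity) hX0 hS0 h46 hSle
  refine hopt.trans ?_
  have h1 : n ^ (2 * δ') * (n ^ (6 / 5 : ℝ) * n ^ ((12 - 20 * σ) / 5)) ≤
      n ^ (6 / 5 : ℝ) * n ^ ((12 - 20 * σ) / 5 + δ) := by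
    have e1 : n ^ (2 * δ') * (n ^ (6 / 5 : ℝ) * n ^ ((12 - 20 * σ) / 5)) =
        n ^ (6 / 5 : ℝ) * n ^ ((12 - 20 * σ) / 5 + 2 * δ') := by
      rw [Real.rpow_add hN0 ((12 - 20 * σ) / 5) (2 * δ')]; ring
    rw [e1]
    exact mul_le_mul_of_nonneg_left
      (Real.rpow_le_rpow_of_exponent_le hN1 (by rw [hδ']; linarith)) (by positivity)
  calc C * n ^ (2 * δ') * (n ^ (6 / 5 : ℝ) * n ^ ((12 - 20 * σ) / 5))
      = C * (n ^ (2 * δ') * (n ^ (6 / 5 : ℝ) * n ^ ((12 - 20 * σ) / 5))) := by ring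
    _ ≤ C * (n ^ (6 / 5 : ℝ) * n ^ ((12 - 20 * σ) / 5 + δ)) := by gcongr
    _ = _ := by ring

/-- **`zeroDensity_guth_maynard` from the three analytic cores of Guth–Maynard's proof of
Proposition 3.1.** If for every admissible weight `w` (smooth, supported in `[1,2]`, equal to `1` on
`[6/5, 9/5]`, with values in `[0,1]`; such `w` exist, `exists_weight`) the bounds of
Proposition 6.1 with `k = 4` for `S₂` (`hS2`) and of Proposition 10.1 for `S₃` (`hS3`) hold in the
setting of Proposition 3.1, and the energy bound of Proposition 11.1 holds for `T = N^{6/5}`,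
`σ ∈ [7/10, 4/5]` (`hE`), then Guth–Maynard's zero-density estimate
`N(σ,T) ≪ T^{15(1−σ)/(3+5σ)+ε}` (`σ ≥ 7/10`) holds: by `keyProp_of_bounds` (§12),
`zeroDensity_guth_maynard_of_keyProp` (§3 and §13 of the paper, the tree's Ingham and Huxley
estimates). The hypotheses are stated for the objects `S2`, `S3` of
`LargeValuesTraceExpansion.lean` and `addEnergy`; they are §6 (via Heath-Brown's theorem),
§§7–10 and §11 of the paper respectively, and are not in the tree.
[cite: GuthMaynard2026, Propositions 6.1, 10.1, 11.1, Section 12, Theorem 1.2] -/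
theorem zeroDensity_guth_maynard_of_bounds
    (hS2 : ∀ w : ℝ → ℝ, ContDiff ℝ ∞ w → Function.support w ⊆ Set.Icc 1 2 →
      (∀ u : ℝ, 6 / 5 ≤ u → u ≤ 9 / 5 → w u = 1) → (∀ u, 0 ≤ w u ∧ w u ≤ 1) →
      ∀ ε : ℝ, 0 < ε → ∀ δ : ℝ, 0 < δ → ∃ C N₀ : ℝ, ∀ N : ℕ, N₀ ≤ (N : ℝ) →
      ∀ (t₀ : ℝ) (W : Finset ℝ), (∀ t ∈ W, t₀ ≤ t ∧ t ≤ t₀ + (N : ℝ) ^ (6 / 5 : ℝ)) →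
      (∀ t ∈ W, ∀ t' ∈ W, t ≠ t' → ((N : ℝ) ^ (6 / 5 : ℝ)) ^ ε ≤ |t - t'|) →
      ‖S2 w N W‖ ≤ C * (N : ℝ) ^ δ * ((N : ℝ) ^ 2 * (W.card : ℝ) ^ 2 +
        (N : ℝ) ^ (6 / 5 : ℝ) * N * (W.card : ℝ) ^ (7 / 4 : ℝ) +
        (N : ℝ) ^ 2 * ((N : ℝ) ^ (6 / 5 : ℝ)) ^ (1 / 8 : ℝ) * (W.card : ℝ) ^ (29 / 16 : ℝ)))
    (hS3 : ∀ w : ℝ → ℝ, ContDiff ℝ ∞ w → Function.support w ⊆ Set.Icc 1 2 →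
      (∀ u : ℝ, 6 / 5 ≤ u → u ≤ 9 / 5 → w u = 1) → (∀ u, 0 ≤ w u ∧ w u ≤ 1) →
      ∀ ε : ℝ, 0 < ε → ∀ δ : ℝ, 0 < δ → ∃ C N₀ : ℝ, ∀ N : ℕ, N₀ ≤ (N : ℝ) →
      ∀ (t₀ : ℝ) (W : Finset ℝ), (∀ t ∈ W, t₀ ≤ t ∧ t ≤ t₀ + (N : ℝ) ^ (6 / 5 : ℝ)) →
      (∀ t ∈ W, ∀ t' ∈ W, t ≠ t' → ((N : ℝ) ^ (6 / 5 : ℝ)) ^ ε ≤ |t - t'|) →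
      ‖S3 w N W‖ ≤ C * (N : ℝ) ^ δ * (((N : ℝ) ^ (6 / 5 : ℝ)) ^ 2 * (W.card : ℝ) ^ (3 / 2 : ℝ) +
        (N : ℝ) ^ (6 / 5 : ℝ) * N * (W.card : ℝ) ^ (1 / 2 : ℝ) * (addEnergy W) ^ (1 / 2 : ℝ)))
    (hE : ∀ σ : ℝ, 7 / 10 ≤ σ → σ ≤ 4 / 5 → ∀ δ : ℝ, 0 < δ → ∃ C N₀ : ℝ, ∀ N : ℕ, N₀ ≤ (N : ℝ) →
      ∀ (a : ℕ → ℂ) (t₀ : ℝ) (W : Finset ℝ), (∀ n, ‖a n‖ ≤ 1) →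
      (∀ t ∈ W, t₀ ≤ t ∧ t ≤ t₀ + (N : ℝ) ^ (6 / 5 : ℝ)) →
      (∀ t ∈ W, ∀ t' ∈ W, t ≠ t' → 1 ≤ |t - t'|) →
      (∀ t ∈ W, (N : ℝ) ^ σ ≤ ‖∑ n ∈ Finset.Icc N (2 * N), a n * (n : ℂ) ^ ((t : ℂ) * I)‖) →
      addEnergy W ≤ C * (N : ℝ) ^ δ * ((W.card : ℝ) * (N : ℝ) ^ (4 - 4 * σ) +
        (W.card : ℝ) ^ (21 / 8 : ℝ) * ((N : ℝ) ^ (6 / 5 : ℝ)) ^ (1 / 4 : ℝ) * (N : ℝ) ^ (1 - 2 * σ) +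
        (W.card : ℝ) ^ 3 * (N : ℝ) ^ (1 - 2 * σ))) :
    zeroDensity_guth_maynard := by
  obtain ⟨w, hw, hsupp, hw1, hw01⟩ := exists_weight
  have hwb : ∀ u, |w u| ≤ 1 := fun u ↦ by
    rw [abs_le]; constructor <;> linarith [(hw01 u).1, (hw01 u).2]
  exact zeroDensity_guth_maynard_of_keyProp hw1
    (keyProp_of_bounds hw hsupp hwb (hS2 w hw hsupp hw1 hw01) (hS3 w hw hsupp hw1 hw01) hE)

end GuthMaynardAssembly

end Literature.NumberTheory.LFunctions

end
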